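import Literature.NumberTheory.Rogawski1990.RankOneUnstableWildWindowLaw            -- ★ p844448 B-p14 (g33) (B6-V) (V-win) V2: `exists_windowForms_setIntegral_shellConjugate_sub_eq_hilbertSymbol_mul`
import Literature.NumberTheory.Automorphic.EisensteinTorusCoordsContinuous            -- ★ B-p04 (g35): `continuousAt_eisensteinCoords`, `continuous_conj_coe_placeModel`, `continuousAt_descentForm_windowMatrix`
import Literature.NumberTheory.Rogawski1990.RankOneTorusDepthContinuity               -- ★ `frame_of_mem_centralizer`, `isRegularElt_iff_frameEntry_ne` (the frame along `Z(t₀)`)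
import Literature.NumberTheory.Rogawski1990.RankOneKappaOrbitalDepthExpansionH        -- ★ `coe_localNonsplitEquiv_mul_map_eq` (the frame read at `w`)
import Literature.NumberTheory.Automorphic.UnitaryGroupInertPlaceHyperbolicBasis      -- ★ `exists_toPlace_eq_of_galAdicCompletionMap_eq`, `galAdicCompletionMap_galAdicCompletionMap_of_smul_eq`
import Literature.NumberTheory.Automorphic.RamifiedPlaceEisensteinBasis               -- ★ `valued_toPlace_eq_sq_of_ramified`
import Literature.NumberTheory.Automorphic.RamifiedPlaceResidueFieldBridge            -- ★ `valued_toPlace_eq_one_iff`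
import Literature.NumberTheory.Automorphic.UnitaryTwoTorusStandardPosition            -- ★ `map_mul_mul_map_det_eq_one_of_conj_diagonal_eq` (unitarity in the conjugated frame)
import HarnessLib

/-!
# (B6-V) «THE VALUE LAWS ON THE TORUS» — THE WINDOW SIDE: window averages `Φ ΦD`, their families `Nf NDf`, the WINDOW LAW `hwin` and the
# CONTINUITY `hcont` at the singular points, from abstract Eisenstein coordinates `(ζ, β, oT)` (road «W′» = «R1LL-WILD»; Labesse–Langlands (2.1)–(2.2))

Topic `NumberTheory/Rogawski1990`; namespace `Literature.NumberTheory.Rogawski1990`.  THEOREMS ONLY (no definition, no instance, no notation, no named fact,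
no `sorry`).  Cell `pub/hodgecm-mathlib` (D-0151), crux H413 = `stmt-HodgeConjecture-24833`, line «N6nsGerm», wild residue; (B6-V) HEAD `exists_wildValueLaws` =
F0P3a-p08 (g16) (statement-first stub v1, 13:12:45Z), design of record B-p14 (g33) `HANDOFF-B6V-HEAD.B-p14g33.md` 30fdf257 §3; this file = B-p14 (g34)'s «cut W»
(bus 13:16:01Z): the BACK HALF of the HEAD, importable, keyed to the HEAD's binders and to three facts about the coordinates that the HEAD's front half proves.

THE MATHEMATICS.  Along the framed elliptic torus `Z(t₀) ⊂ H_v = U(Φ₂)_v × U(Φ₁)_v` at a RAMIFIED non-split `w ∣ v`, write `X_t ∈ U_w ⊂ GL₂(L_w)` for the one-place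
matrix of `t` and suppose Eisenstein coordinates `ζ t ∈ L_w`, `β t ∈ L⁺_v` in the normal form `diag(1,α) X_t diag(1,α)⁻¹ = ζ t · ι_w(1, β v₀; β, 1 + β u₀)` wherever the
corner `(X_t)₀₀` is non-zero (`hnf`), with `(X_t)₀₀ ≠ 0` and `|β t|_v = exp(−oT t) ≤ exp(−j)` on the deep regular locus (`h00`, `hoT`).  Then, with the EXPLICIT window
elements `X_A(i,t), X_B(i,t) ∈ U_w` of ★ V2 (matrices `diag(1,α)⁻¹ (ζ t · ι A_i(β t)) diag(1,α)`, `A_i(β) = (1, v₀ c^i c^{−j} β²; c^j c^{−i}, 1 + β u₀)`, `B_i` the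
`u_F`-twist; `c = N(ηE)`, `u = ι u_F`), the window averages `Φ i t := F̄(X_A(i,t), t₂)`, `ΦD i t := F̄(X_B(i,t), t₂)` and families `Nf i t := (E₂⁻¹ X_A(i,t), t₂)` satisfy:
(hwin) the WINDOW LAW `F̄_{oT t − j + i}(t) − F̄_{oT t − j + i}(e t) = (β t, θ)_v · (Φ i t − ΦD i t)` on the deep regular locus (★ V2 + the `fbar` link ★
`prod_symm_one_inv_mul_mul`); (hΦ) the averages are `K × U(Φ₁)`-orbital means of the families (by construction); (hcont) the families are CONTINUOUS AT EVERY SINGULAR `s`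
— at a singular point `X_s` is SCALAR (it is framed with a double eigenvalue, §1), so the corner is non-zero near `s`, the coordinates `ζ, β` are continuous at `s` (★ B-p04
`continuousAt_eisensteinCoords`, `ι_w` a closed embedding) and the window matrices, polynomial in `(ζ t, β t)`, are unitary near `s` (§0: `σ(ζ)ζ·ι det = 1`, ★
`exists_mem_unitaryGroupOfForm_conj_eq_smul_map`) and continuous at `s` (★ `continuousAt_descentForm_windowMatrix`, ★ `continuousAt_windowFamily_centralizer_of_coe`).
* §0 bookkeeping at the place: the non-norm unit `u_F` below `u` (`exists_unit_toPlace_eq_of_not_exists_norm`), the norm uniformiser `c = N(ηE)` (`exists_uniformizer_toPlace_eq_mul`),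
  unitarity of descent normal forms (`map_mul_mul_map_det_eq_one_of_coe_descent`, `exists_coe_eq_descentForm_of_det`), the window determinants.
* §1 `exists_coe_eq_smul_one_of_not_isRegularElt` (singular ⇒ scalar one-place matrix, non-zero scalar).
* §2 HEAD OF THIS FILE `exists_windowSide_of_coords` (conclusion = the (B6-V) HEAD's conjuncts `hwin ∧ hΦ ∧ hΦD ∧ hcont` VERBATIM, `Φ ΦD Nf NDf` existential).
HONEST LABEL: HC_CM is proved only modulo the 2 remaining named inputs (hLiu418, h413) until rung 0 closes; this file is unconditional bookkeeping over ★ lemmas.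

## References
* [LabesseLanglands1979] J.-P. Labesse, R. P. Langlands, *L-indistinguishability for SL(2)*, Canad. J. Math. 31 (1979): §2 (2.1)–(2.2) pp. 8–9 (windows, the sign).
* [Labesse2024StabilisationGermesSL2] J.-P. Labesse, *Stabilisation des germes de SL(2)* (2024): Prop. 0.0.11, Th. 0.0.12 (the unstable germ at a ramified torus).
* [Rogawski1990] J. D. Rogawski, *Automorphic Representations of Unitary Groups in Three Variables*, Ann. of Math. Stud. 123 (1990): §3.6 pp. 31–32, §4.9 Lemma 4.9.3 p. 56.
* [PlatonovRapinchuk1994] V. Platonov, A. Rapinchuk, *Algebraic Groups and Number Theory* (1994): §3.1, §5.1 (topology of `G(K_v)`, `F_v ⊂ E_w` closed).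
-/

set_option autoImplicit false

noncomputable section

open Set Filter Topology MeasureTheory NumberField IsDedekindDomain Finset Matrix ValuativeRel Function MulAction
open scoped Matrix MatrixGroups ValuativeRel WithZero

namespace Literature.NumberTheory.Rogawski1990

open Literature.NumberTheory.Automorphic Literature.NumberTheory.Automorphic.UnitaryGroup Literature.NumberTheory.GaloisRepresentations
open Literature.NumberTheory.QuadraticForms Literature.NumberTheory.NumberFields Literature.NumberTheory.Automorphic.HermitianLatticeTree

/-! ## §0 Bookkeeping at the ramified place -/

section Place

variable (L : Type) [Field L] [NumberField L] [IsCMField L] (v : HeightOneSpectrum (𝓞 ↥(maximalRealSubfield L)))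
  (w : PlacesOver L v) (hw : IsCMField.complexConj L • w.1 = w.1)

include hw in
/-- **The non-norm unit below `u`**: a `σ_w`-fixed unit `u` of `L_w` which is not a norm is `ι_w u_F` for a unit `u_F` of `L⁺_v` with `(u_F, θ)_v = −1`
(`σ_w`-fixed ⇒ from `L⁺_v` at a non-split place; `|ι u_F|_w = 1 ⇔ |u_F|_v = 1`; ★ `hilbertSymbol_eq_neg_one_of_not_exists_norm`). [cite: LabesseLanglands1979, §2 p. 9] -/
theorem exists_unit_toPlace_eq_of_not_exists_norm
    (u : ((w.1.adicCompletion L))ˣ) (hvu : Valued.v (u : (w.1.adicCompletion L)) = 1) (hσu : (galAdicCompletionMap (L := L) (IsCMField.complexConj L) hw) (u : (w.1.adicCompletion L)) = u) (hun : ¬ ∃ z : (w.1.adicCompletion L), (u : (w.1.adicCompletion L)) = (galAdicCompletionMap (L := L) (IsCMField.complexConj L) hw) z * z) :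
    ∃ uF : (v.adicCompletion ↥(maximalRealSubfield L)), uF ≠ 0 ∧ valuation (v.adicCompletion ↥(maximalRealSubfield L)) uF = 1 ∧
      hilbertSymbol (v.adicCompletion ↥(maximalRealSubfield L)) uF (algebraMap ↥(maximalRealSubfield L) (v.adicCompletion ↥(maximalRealSubfield L)) ((cmQuadraticGenerator L : 𝓞 ↥(maximalRealSubfield L)) : ↥(maximalRealSubfield L))) = -1 ∧ (u : (w.1.adicCompletion L)) = toPlace v w uF := by
  obtain ⟨uF, huF⟩ := exists_toPlace_eq_of_galAdicCompletionMap_eq (c := IsCMField.complexConj L) (w := w) (IsCMField.complexConj_ne_one L) hw (u : (w.1.adicCompletion L)) hσu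
  have hvF1 : Valued.v uF = 1 := (valued_toPlace_eq_one_iff L v w uF).1 (by rw [huF]; exact hvu)
  have huF1 : valuation (v.adicCompletion ↥(maximalRealSubfield L)) uF = 1 :=
    (ValuativeRel.isEquiv (valuation (v.adicCompletion ↥(maximalRealSubfield L))) (Valued.v : Valuation (v.adicCompletion ↥(maximalRealSubfield L)) (WithZero (Multiplicative ℤ)))).eq_one_iff_eq_one.2 hvF1
  have huF0 : uF ≠ 0 := by
    intro h
    rw [h, map_zero] at hvF1
    exact zero_ne_one hvF1
  refine ⟨uF, huF0, huF1, hilbertSymbol_eq_neg_one_of_not_exists_norm L v w hw huF0 ?_, huF.symm⟩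
  rw [huF]
  exact hun

include hw in
/-- **The norm uniformiser `c = N(ηE)`**: for a uniformiser `ηE` of `L_w` (ramified `w ∣ v`) there is `c ∈ L⁺_v` with `ι_w c = ηE · σ_w ηE`, and `c` is a uniformiser of `L⁺_v`
(`|ι c|_w = exp(−2) = |c|_v²`). [cite: LabesseLanglands1979, §2 (2.2) p. 9] -/
theorem exists_uniformizer_toPlace_eq_mul (he : v.asIdeal.ramificationIdx' w.1.asIdeal ≠ 1)
    (ηE : ((w.1.adicCompletion L))ˣ) (hηE : Valued.v (ηE : (w.1.adicCompletion L)) = WithZero.exp (-1 : ℤ)) :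
    ∃ c : (v.adicCompletion ↥(maximalRealSubfield L)), c ≠ 0 ∧ toPlace v w c = (ηE : (w.1.adicCompletion L)) * (galAdicCompletionMap (L := L) (IsCMField.complexConj L) hw) (ηE : (w.1.adicCompletion L)) ∧ Valued.v c = WithZero.exp (-1 : ℤ) := by
  have hσN : (galAdicCompletionMap (L := L) (IsCMField.complexConj L) hw) ((ηE : (w.1.adicCompletion L)) * (galAdicCompletionMap (L := L) (IsCMField.complexConj L) hw) (ηE : (w.1.adicCompletion L))) = (ηE : (w.1.adicCompletion L)) * (galAdicCompletionMap (L := L) (IsCMField.complexConj L) hw) (ηE : (w.1.adicCompletion L)) := by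
    rw [map_mul, galAdicCompletionMap_galAdicCompletionMap_of_smul_eq (IsCMField.complexConj L) w (IsCMField.complexConj_ne_one L) hw, mul_comm]
  obtain ⟨c, hc⟩ := exists_toPlace_eq_of_galAdicCompletionMap_eq (c := IsCMField.complexConj L) (w := w) (IsCMField.complexConj_ne_one L) hw _ hσN
  have hvc2 : Valued.v c ^ 2 = WithZero.exp (-2 : ℤ) := by
    rw [← valued_toPlace_eq_sq_of_ramified L v w hw he c, hc, map_mul, valued_galAdicCompletionMap, hηE, ← WithZero.exp_add]
    norm_num
  have hc0' : Valued.v c ≠ 0 := by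
    intro h
    rw [h, zero_pow two_ne_zero] at hvc2
    exact WithZero.zero_ne_coe hvc2
  have hvc : Valued.v c = WithZero.exp (-1 : ℤ) := by
    rw [← WithZero.exp_log hc0'] at hvc2 ⊢
    rw [← WithZero.exp_nsmul, WithZero.exp_inj] at hvc2
    rw [WithZero.exp_inj]
    have h2 : (2 : ℤ) * WithZero.log (Valued.v c) = -2 := by simpa [nsmul_eq_mul] using hvc2
    omega
  exact ⟨c, (Valuation.ne_zero_iff _).1 hc0', hc, hvc⟩

/-- **Unitarity of a descent normal form** (`U_w`-version of ★ `map_mul_mul_map_det_eq_one_of_conj_diagonal_eq`): if `X ∈ U_w` descends as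
`diag(1,α) X diag(1,α)⁻¹ = ζ • ι_w M` then `σ_w(ζ) ζ ι_w(det M) = 1`. [cite: Rogawski1990, §3.6 p. 31] -/
theorem map_mul_mul_map_det_eq_one_of_coe_descent {α : (w.1.adicCompletion L)} (hα : (galAdicCompletionMap (L := L) (IsCMField.complexConj L) hw) α = -α) (hα0 : α ≠ 0)
    (X : ↥(unitaryGroupOfForm (galAdicCompletionMap (L := L) (IsCMField.complexConj L) hw) (placeForm (Matrix.of fun i j : Fin 2 => if i.val + j.val + 1 = 2 then (1 : L) else 0) w.1))) {ζ : (w.1.adicCompletion L)} {M : Matrix (Fin 2) (Fin 2) (v.adicCompletion ↥(maximalRealSubfield L))}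
    (hX : Matrix.diagonal ![1, α] * (((X : ↥(unitaryGroupOfForm (galAdicCompletionMap (L := L) (IsCMField.complexConj L) hw) (placeForm (Matrix.of fun i j : Fin 2 => if i.val + j.val + 1 = 2 then (1 : L) else 0) w.1))) : GL (Fin 2) (w.1.adicCompletion L)) : Matrix (Fin 2) (Fin 2) (w.1.adicCompletion L)) * Matrix.diagonal ![1, α⁻¹] = ζ • M.map (toPlace v w)) :
    (galAdicCompletionMap (L := L) (IsCMField.complexConj L) hw) ζ * ζ * toPlace v w M.det = 1 := by
  have hσι : ∀ x, (galAdicCompletionMap (L := L) (IsCMField.complexConj L) hw) (toPlace v w x) = toPlace v w x := fun x => galAdicCompletionMap_toPlace (IsCMField.complexConj L) w w hw x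
  have hX2 : ((X : ↥(unitaryGroupOfForm (galAdicCompletionMap (L := L) (IsCMField.complexConj L) hw) (placeForm (Matrix.of fun i j : Fin 2 => if i.val + j.val + 1 = 2 then (1 : L) else 0) w.1))) : GL (Fin 2) (w.1.adicCompletion L)) ∈ unitaryGroupOfForm (galAdicCompletionMap (L := L) (IsCMField.complexConj L) hw) !![(0 : (w.1.adicCompletion L)), 1; 1, 0] := by
    rw [← unitaryGroupOfForm_placeForm_antidiagTwo_eq L v w (galAdicCompletionMap (L := L) (IsCMField.complexConj L) hw)]
    exact X.2
  exact map_mul_mul_map_det_eq_one_of_conj_diagonal_eq (toPlace v w) (galAdicCompletionMap (L := L) (IsCMField.complexConj L) hw) hσι hα hα0 hX2 hX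

/-- **Unitary lifts of a descent normal form** (`U_w`-version of ★ `exists_mem_unitaryGroupOfForm_conj_eq_smul_map`): if `σ_w(ζ) ζ ι_w(det M) = 1` then
`diag(1,α)⁻¹ (ζ • ι_w M) diag(1,α)` is the matrix of an element of `U_w`. [cite: Rogawski1990, §3.6 p. 31] -/
theorem exists_coe_eq_descentForm_of_det {α : (w.1.adicCompletion L)} (hα : (galAdicCompletionMap (L := L) (IsCMField.complexConj L) hw) α = -α) (hα0 : α ≠ 0)
    {ζ : (w.1.adicCompletion L)} {M : Matrix (Fin 2) (Fin 2) (v.adicCompletion ↥(maximalRealSubfield L))} (h : (galAdicCompletionMap (L := L) (IsCMField.complexConj L) hw) ζ * ζ * toPlace v w M.det = 1) :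
    ∃ X : ↥(unitaryGroupOfForm (galAdicCompletionMap (L := L) (IsCMField.complexConj L) hw) (placeForm (Matrix.of fun i j : Fin 2 => if i.val + j.val + 1 = 2 then (1 : L) else 0) w.1)), (((X : ↥(unitaryGroupOfForm (galAdicCompletionMap (L := L) (IsCMField.complexConj L) hw) (placeForm (Matrix.of fun i j : Fin 2 => if i.val + j.val + 1 = 2 then (1 : L) else 0) w.1))) : GL (Fin 2) (w.1.adicCompletion L)) : Matrix (Fin 2) (Fin 2) (w.1.adicCompletion L)) = Matrix.diagonal ![1, α⁻¹] * (ζ • M.map (toPlace v w)) * Matrix.diagonal ![1, α] := by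
  have hσι : ∀ x, (galAdicCompletionMap (L := L) (IsCMField.complexConj L) hw) (toPlace v w x) = toPlace v w x := fun x => galAdicCompletionMap_toPlace (IsCMField.complexConj L) w w hw x
  have hζ : ζ ≠ 0 := by
    rintro rfl
    rw [mul_zero, zero_mul] at h
    exact zero_ne_one h
  have hdet : M.det ≠ 0 := by
    intro hM
    rw [hM, map_zero, mul_zero] at h
    exact zero_ne_one h
  obtain ⟨g, hg⟩ : ∃ g : GL (Fin 2) (v.adicCompletion ↥(maximalRealSubfield L)), ((g : GL (Fin 2) (v.adicCompletion ↥(maximalRealSubfield L))) : Matrix (Fin 2) (Fin 2) (v.adicCompletion ↥(maximalRealSubfield L))) = M := ⟨Matrix.GeneralLinearGroup.mk'' _ (isUnit_iff_ne_zero.2 hdet), rfl⟩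
  rw [← hg] at h
  obtain ⟨u, hu⟩ := exists_mem_unitaryGroupOfForm_conj_eq_smul_map (toPlace v w) (galAdicCompletionMap (L := L) (IsCMField.complexConj L) hw) hσι hα hα0 h
  refine ⟨Subgroup.inclusion (unitaryGroupOfForm_placeForm_antidiagTwo_eq L v w _).ge u, ?_⟩
  rw [Subgroup.coe_inclusion, eq_diagonal_inv_mul_mul_diagonal_of_descent hα0 hu, hg]

end Place

/-! ### The window determinants -/

section Det

variable {F : Type*} [Field F]

/-- `det A_i(β) = det (1, β v₀; β, 1 + β u₀)`: the shell factors `c^{±(j−i)}` cancel. [cite: LabesseLanglands1979, §2 (2.1) p. 8] -/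
theorem det_windowA_eq {c : F} (hc0 : c ≠ 0) (i j : ℕ) (β u₀ v₀ : F) :
    (!![(1 : F), v₀ * c ^ i * (c ^ j)⁻¹ * β ^ 2; c ^ j * (c ^ i)⁻¹, 1 + β * u₀]).det = (!![(1 : F), β * v₀; β, 1 + β * u₀]).det := by
  simp only [Matrix.det_fin_two_of]
  field_simp

/-- `det B_i(β) = det (1, β v₀; β, 1 + β u₀)`: the shell factors and the twist `u_F^{±1}` cancel. [cite: LabesseLanglands1979, §2 (2.1) p. 8] -/
theorem det_windowB_eq {c uF : F} (hc0 : c ≠ 0) (huF0 : uF ≠ 0) (i j : ℕ) (β u₀ v₀ : F) :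
    (!![(1 : F), v₀ * c ^ i * (c ^ j)⁻¹ * uF⁻¹ * β ^ 2; c ^ j * (c ^ i)⁻¹ * uF, 1 + β * u₀]).det = (!![(1 : F), β * v₀; β, 1 + β * u₀]).det := by
  simp only [Matrix.det_fin_two_of]
  field_simp

end Det

/-! ## §1 At a singular point of the torus the one-place matrix is a non-zero scalar -/

section Singular

variable (L : Type) [Field L] [NumberField L] [IsCMField L] (v : HeightOneSpectrum (𝓞 ↥(maximalRealSubfield L)))
  (w : PlacesOver L v) (hw : IsCMField.complexConj L • w.1 = w.1)
  (t₀ : ((cmDatum L 2 (Matrix.of fun i j : Fin 2 => if i.val + j.val + 1 = 2 then (1 : L) else 0)).Local v × (cmDatum L 1 (Matrix.of fun i j : Fin 1 => if i.val + j.val + 1 = 1 then (1 : L) else 0)).Local v)) (P : GL (Fin 2) (LocalRing L v)) (d : Fin 2 → LocalRing L v) (ht₀ : IsRegularElt (t₀.1.val : GL (Fin 2) (LocalRing L v)))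
  (hP : (t₀.1.val.val : Matrix (Fin 2) (Fin 2) (LocalRing L v)) * P.val = P.val * Matrix.diagonal d) (hd1 : ∀ i, conjLocal L (IsCMField.complexConj L) v (d i) * d i = 1)

include hw ht₀ hP hd1 in
/-- **SINGULAR ⇒ SCALAR**: at `s ∈ Z(t₀)` with `s.1` NOT regular, the one-place matrix `X_s` of `s` is `τ • 1` with `τ ≠ 0` — `s.1` is framed by `P` with the double
eigenvalue `τ₀ s = τ₁ s` (★ `frame_of_mem_centralizer`, ★ `isRegularElt_iff_frameEntry_ne`), read at `w` (★ `coe_localNonsplitEquiv_mul_map_eq`).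
[cite: Rogawski1990, §3.6 pp. 31–32; §4.9 p. 56] -/
theorem exists_coe_eq_smul_one_of_not_isRegularElt
    (E₂ : (cmDatum L 2 (Matrix.of fun i j : Fin 2 => if i.val + j.val + 1 = 2 then (1 : L) else 0)).Local v ≃ₜ* ↥(unitaryGroupOfForm (galAdicCompletionMap (L := L) (IsCMField.complexConj L) hw) (placeForm (Matrix.of fun i j : Fin 2 => if i.val + j.val + 1 = 2 then (1 : L) else 0) w.1))) (hE₂ : ∀ g, ((E₂ g : ↥(unitaryGroupOfForm (galAdicCompletionMap (L := L) (IsCMField.complexConj L) hw) (placeForm (Matrix.of fun i j : Fin 2 => if i.val + j.val + 1 = 2 then (1 : L) else 0) w.1))) : GL (Fin 2) (w.1.adicCompletion L)) = ((localNonsplitEquiv (IsCMField.complexConj L) (Matrix.of fun i j : Fin 2 => if i.val + j.val + 1 = 2 then (1 : L) else 0) (IsCMField.complexConj_ne_one L) w hw g : ↥(unitaryGroupOfForm (galAdicCompletionMap (L := L) (IsCMField.complexConj L) hw) (placeForm (Matrix.of fun i j : Fin 2 => if i.val + j.val + 1 = 2 then (1 : L) else 0) w.1))) : GL (Fin 2)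 (w.1.adicCompletion L)))
    (s : ↥(Subgroup.centralizer ({t₀} : Set ((cmDatum L 2 (Matrix.of fun i j : Fin 2 => if i.val + j.val + 1 = 2 then (1 : L) else 0)).Local v × (cmDatum L 1 (Matrix.of fun i j : Fin 1 => if i.val + j.val + 1 = 1 then (1 : L) else 0)).Local v)))) (hs : ¬ IsRegularElt ((s : ((cmDatum L 2 (Matrix.of fun i j : Fin 2 => if i.val + j.val + 1 = 2 then (1 : L) else 0)).Local v × (cmDatum L 1 (Matrix.of fun i j : Fin 1 => if i.val + j.val + 1 = 1 then (1 : L) else 0)).Local v)).1.val : GL (Fin 2) (LocalRing L v))) :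
    ∃ τ : (w.1.adicCompletion L), τ ≠ 0 ∧ ((((E₂ (s : ((cmDatum L 2 (Matrix.of fun i j : Fin 2 => if i.val + j.val + 1 = 2 then (1 : L) else 0)).Local v × (cmDatum L 1 (Matrix.of fun i j : Fin 1 => if i.val + j.val + 1 = 1 then (1 : L) else 0)).Local v)).1) : ↥(unitaryGroupOfForm (galAdicCompletionMap (L := L) (IsCMField.complexConj L) hw) (placeForm (Matrix.of fun i j : Fin 2 => if i.val + j.val + 1 = 2 then (1 : L) else 0) w.1))) : GL (Fin 2) (w.1.adicCompletion L)) : Matrix (Fin 2) (Fin 2) (w.1.adicCompletion L)) = τ • (1 : Matrix (Fin 2) (Fin 2) (w.1.adicCompletion L)) := by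
  -- the frame of `s.1` with its two eigenvalues, equal since `s.1` is singular
  have hfr := frame_of_mem_centralizer L v w hw t₀ P d ht₀ hP hd1 s
  have hτ : ((P⁻¹).val * ((s : ((cmDatum L 2 (Matrix.of fun i j : Fin 2 => if i.val + j.val + 1 = 2 then (1 : L) else 0)).Local v × (cmDatum L 1 (Matrix.of fun i j : Fin 1 => if i.val + j.val + 1 = 1 then (1 : L) else 0)).Local v)).1.val.val : Matrix (Fin 2) (Fin 2) (LocalRing L v)) * P.val) 0 0 =
      ((P⁻¹).val * ((s : ((cmDatum L 2 (Matrix.of fun i j : Fin 2 => if i.val + j.val + 1 = 2 then (1 : L) else 0)).Local v × (cmDatum L 1 (Matrix.of fun i j : Fin 1 => if i.val + j.val + 1 = 1 then (1 : L) else 0)).Local v)).1.val.val : Matrix (Fin 2) (Fin 2) (LocalRing L v)) * P.val) 1 1 := by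
    by_contra hne
    exact hs ((isRegularElt_iff_frameEntry_ne L v w hw t₀ P d ht₀ hP hd1 s).2 hne)
  set τ := ((P⁻¹).val * ((s : ((cmDatum L 2 (Matrix.of fun i j : Fin 2 => if i.val + j.val + 1 = 2 then (1 : L) else 0)).Local v × (cmDatum L 1 (Matrix.of fun i j : Fin 1 => if i.val + j.val + 1 = 1 then (1 : L) else 0)).Local v)).1.val.val : Matrix (Fin 2) (Fin 2) (LocalRing L v)) * P.val) 0 0 with hτdef
  rw [← hτ] at hfr
  have hdiag : Matrix.diagonal ![τ, τ] = τ • (1 : Matrix (Fin 2) (Fin 2) (LocalRing L v)) := by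
    rw [Matrix.smul_one_eq_diagonal]
    congr 1
    funext k
    fin_cases k <;> rfl
  rw [hdiag] at hfr
  -- read at `w`
  have hXw := coe_localNonsplitEquiv_mul_map_eq L v w hw (s : ((cmDatum L 2 (Matrix.of fun i j : Fin 2 => if i.val + j.val + 1 = 2 then (1 : L) else 0)).Local v × (cmDatum L 1 (Matrix.of fun i j : Fin 1 => if i.val + j.val + 1 = 1 then (1 : L) else 0)).Local v)).1 P (τ • (1 : Matrix (Fin 2) (Fin 2) (LocalRing L v))) hfr
  have hmap : (τ • (1 : Matrix (Fin 2) (Fin 2) (LocalRing L v))).map (Pi.evalRingHom (fun w' : PlacesOver L v => w'.1.adicCompletion L) w) =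
      (Pi.evalRingHom (fun w' : PlacesOver L v => w'.1.adicCompletion L) w τ) • (1 : Matrix (Fin 2) (Fin 2) (w.1.adicCompletion L)) := by
    ext i k
    fin_cases i <;> fin_cases k <;> simp
  rw [← hE₂, hmap, Matrix.mul_smul, Matrix.mul_one] at hXw
  -- cancel the frame `P_w`
  have h1 := congrArg (· * ((((Matrix.GeneralLinearGroup.map (Pi.evalRingHom (fun w' : PlacesOver L v => w'.1.adicCompletion L) w) P))⁻¹ : GL (Fin 2) (w.1.adicCompletion L)) : Matrix (Fin 2) (Fin 2) (w.1.adicCompletion L))) hXw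
  simp only [Units.mul_inv_cancel_right, Matrix.smul_mul, Units.mul_inv] at h1
  refine ⟨Pi.evalRingHom (fun w' : PlacesOver L v => w'.1.adicCompletion L) w τ, ?_, h1⟩
  intro h0
  rw [h0, zero_smul] at h1
  exact Units.ne_zero _ h1

end Singular

/-! ## §2 THE WINDOW SIDE of the (B6-V) HEAD -/

section WindowSide

variable (L : Type) [Field L] [NumberField L] [IsCMField L] (v : HeightOneSpectrum (𝓞 ↥(maximalRealSubfield L)))
  (w : PlacesOver L v) (hw : IsCMField.complexConj L • w.1 = w.1)
  [MeasurableSpace ((cmDatum L 2 (Matrix.of fun i j : Fin 2 => if i.val + j.val + 1 = 2 then (1 : L) else 0)).Local v × (cmDatum L 1 (Matrix.of fun i j : Fin 1 => if i.val + j.val + 1 = 1 then (1 : L) else 0)).Local v)] [BorelSpace ((cmDatum L 2 (Matrix.of fun i j : Fin 2 => if i.val + j.val + 1 = 2 then (1 : L) else 0)).Local v × (cmDatum L 1 (Matrix.of fun i j : Fin 1 => if i.val + j.val + 1 = 1 then (1 : L) else 0)).Local v)] (ν : Measure ((cmDatum L 2 (Matrix.of fun i j : Fin 2 => if i.val + j.val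 + 1 = 2 then (1 : L) else 0)).Local v × (cmDatum L 1 (Matrix.of fun i j : Fin 1 => if i.val + j.val + 1 = 1 then (1 : L) else 0)).Local v)) [ν.IsHaarMeasure]
  (f : ((cmDatum L 2 (Matrix.of fun i j : Fin 2 => if i.val + j.val + 1 = 2 then (1 : L) else 0)).Local v × (cmDatum L 1 (Matrix.of fun i j : Fin 1 => if i.val + j.val + 1 = 1 then (1 : L) else 0)).Local v) → ℂ)
  (t₀ : ((cmDatum L 2 (Matrix.of fun i j : Fin 2 => if i.val + j.val + 1 = 2 then (1 : L) else 0)).Local v × (cmDatum L 1 (Matrix.of fun i j : Fin 1 => if i.val + j.val + 1 = 1 then (1 : L) else 0)).Local v)) (P : GL (Fin 2) (LocalRing L v)) (d : Fin 2 → LocalRing L v) (ht₀ : IsRegularElt (t₀.1.val : GL (Fin 2) (LocalRing L v)))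
  (hP : (t₀.1.val.val : Matrix (Fin 2) (Fin 2) (LocalRing L v)) * P.val = P.val * Matrix.diagonal d) (hd1 : ∀ i, conjLocal L (IsCMField.complexConj L) v (d i) * d i = 1)

-- `L_w`-sized statement: elaboration budget only (no search)
set_option maxHeartbeats 1600000 in
include hw ht₀ hP hd1 in
/-- **(B6-V) THE WINDOW SIDE** of `exists_wildValueLaws` (Labesse–Langlands (2.1)–(2.2) ∕ Labesse 2024 Th. 0.0.12 along the framed elliptic torus `Z(t₀)` at a RAMIFIED
non-split `w ∣ v`).  INPUT: the HEAD's binders and abstract Eisenstein coordinates `ζ β oT` with a sign function `κT`, subject to (hnf) the normal form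
`diag(1,α) X_t diag(1,α)⁻¹ = ζ t • ι_w(1, β t v₀; β t, 1 + β t u₀)` wherever `(X_t)₀₀ ≠ 0`, (h00) `(X_t)₀₀ ≠ 0`, (hoT) `j ≤ oT t ∧ |β t|_v = exp(−oT t)` and (hκT)
`κT t = (β t, θ)_v` on the deep regular locus `mfl ≤ N t`.  OUTPUT: window averages `Φ ΦD` and families `Nf NDf` with (hwin) the window law at the shells `oT t − j + i`,
(hΦ∕hΦD) the averages as `K × U(Φ₁)`-orbital means of the families, (hcont) continuity of the families at every singular point — the conjuncts of the (B6-V) HEAD verbatim.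
[cite: LabesseLanglands1979, §2 (2.1)–(2.2) pp. 8–9] [cite: Labesse2024StabilisationGermesSL2, Prop. 0.0.11, Th. 0.0.12] [cite: Rogawski1990, §4.9 Lemma 4.9.3 p. 56] -/
theorem exists_windowSide_of_coords
    (he : v.asIdeal.ramificationIdx' w.1.asIdeal ≠ 1)
    (u : ((w.1.adicCompletion L))ˣ) (hvu : Valued.v (u : (w.1.adicCompletion L)) = 1) (hσu : (galAdicCompletionMap (L := L) (IsCMField.complexConj L) hw) (u : (w.1.adicCompletion L)) = u) (hun : ¬ ∃ z : (w.1.adicCompletion L), (u : (w.1.adicCompletion L)) = (galAdicCompletionMap (L := L) (IsCMField.complexConj L) hw) z * z)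
    (E₂ : (cmDatum L 2 (Matrix.of fun i j : Fin 2 => if i.val + j.val + 1 = 2 then (1 : L) else 0)).Local v ≃ₜ* ↥(unitaryGroupOfForm (galAdicCompletionMap (L := L) (IsCMField.complexConj L) hw) (placeForm (Matrix.of fun i j : Fin 2 => if i.val + j.val + 1 = 2 then (1 : L) else 0) w.1))) (hE₂ : ∀ g, ((E₂ g : ↥(unitaryGroupOfForm (galAdicCompletionMap (L := L) (IsCMField.complexConj L) hw) (placeForm (Matrix.of fun i j : Fin 2 => if i.val + j.val + 1 = 2 then (1 : L) else 0) w.1))) : GL (Fin 2) (w.1.adicCompletion L)) = ((localNonsplitEquiv (IsCMField.complexConj L) (Matrix.of fun i j : Fin 2 => if i.val + j.val + 1 = 2 then (1 : L) else 0) (IsCMField.complexConj_ne_one L) w hw g : ↥(unitaryGroupOfForm (galAdicCompletionMap (L := L) (IsCMField.complexConj L) hw) (placeForm (Matrix.of fun i j : Fin 2 => if i.val + j.val + 1 = 2 then (1 : L) else 0) w.1))) : GL (Fin 2) (w.1.adicCompletion L)))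
    (e : ((cmDatum L 2 (Matrix.of fun i j : Fin 2 => if i.val + j.val + 1 = 2 then (1 : L) else 0)).Local v × (cmDatum L 1 (Matrix.of fun i j : Fin 1 => if i.val + j.val + 1 = 1 then (1 : L) else 0)).Local v) ≃ₜ* ((cmDatum L 2 (Matrix.of fun i j : Fin 2 => if i.val + j.val + 1 = 2 then (1 : L) else 0)).Local v × (cmDatum L 1 (Matrix.of fun i j : Fin 1 => if i.val + j.val + 1 = 1 then (1 : L) else 0)).Local v)) (he2 : ∀ a : ((cmDatum L 2 (Matrix.of fun i j : Fin 2 => if i.val + j.val + 1 = 2 then (1 : L) else 0)).Local v × (cmDatum L 1 (Matrix.of fun i j : Fin 1 => if i.val + j.val + 1 = 1 then (1 : L) else 0)).Local v), (e a).2 = a.2)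
    (hconj : ∀ a : ((cmDatum L 2 (Matrix.of fun i j : Fin 2 => if i.val + j.val + 1 = 2 then (1 : L) else 0)).Local v × (cmDatum L 1 (Matrix.of fun i j : Fin 1 => if i.val + j.val + 1 = 1 then (1 : L) else 0)).Local v), ((E₂ (e a).1 : ↥(unitaryGroupOfForm (galAdicCompletionMap (L := L) (IsCMField.complexConj L) hw) (placeForm (Matrix.of fun i j : Fin 2 => if i.val + j.val + 1 = 2 then (1 : L) else 0) w.1))) : GL (Fin 2) (w.1.adicCompletion L)) = (glDiagonal 2 (w.1.adicCompletion L) ![1, u]) * ((E₂ a.1 : ↥(unitaryGroupOfForm (galAdicCompletionMap (L := L) (IsCMField.complexConj L) hw) (placeForm (Matrix.of fun i j : Fin 2 => if i.val + j.val + 1 = 2 then (1 : L) else 0) w.1))) : GL (Fin 2) (w.1.adicCompletion L)) * ((glDiagonal 2 (w.1.adicCompletion L) ![1, u]))⁻¹)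
    {α : (w.1.adicCompletion L)} (hα : (galAdicCompletionMap (L := L) (IsCMField.complexConj L) hw) α = -α) (hα0 : α ≠ 0)
    {ϖF : (v.adicCompletion ↥(maximalRealSubfield L))} (hϖF : Valued.v ϖF = WithZero.exp (-1 : ℤ))
    (K : Subgroup ((cmDatum L 2 (Matrix.of fun i j : Fin 2 => if i.val + j.val + 1 = 2 then (1 : L) else 0)).Local v))
    (x₀ : {M : Submodule 𝒪[(v.adicCompletion ↥(maximalRealSubfield L))] (Fin 2 → (v.adicCompletion ↥(maximalRealSubfield L))) // IsSpecialLattice (RingHom.id _) ϖF !![(0 : (v.adicCompletion ↥(maximalRealSubfield L))), 1; -1, 0] M})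
    (hx₀ : x₀.1 = latt (1 : Matrix (Fin 2) (Fin 2) (v.adicCompletion ↥(maximalRealSubfield L))))
    (hK : ∀ g, g ∈ K ↔ rhoVertexActPlace L v w hw hα hα0 hϖF (E₂ g) x₀ = x₀) (hKo : IsOpen (((K).prod (⊤ : Subgroup ((cmDatum L 1 (Matrix.of fun i j : Fin 1 => if i.val + j.val + 1 = 1 then (1 : L) else 0)).Local v)) : Subgroup ((cmDatum L 2 (Matrix.of fun i j : Fin 2 => if i.val + j.val + 1 = 2 then (1 : L) else 0)).Local v × (cmDatum L 1 (Matrix.of fun i j : Fin 1 => if i.val + j.val + 1 = 1 then (1 : L) else 0)).Local v)) : Set ((cmDatum L 2 (Matrix.of fun i j : Fin 2 => if i.val + j.val + 1 = 2 then (1 : L) else 0)).Local v × (cmDatum L 1 (Matrix.of fun i j : Fin 1 => if i.val + j.val + 1 = 1 then (1 : L) else 0)).Local v)))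
    {u₀ v₀ : (v.adicCompletion ↥(maximalRealSubfield L))}
    (ηE : ((w.1.adicCompletion L))ˣ) (hηE : Valued.v (ηE : (w.1.adicCompletion L)) = WithZero.exp (-1 : ℤ))
    (uη : ↥(unitaryGroupOfForm (galAdicCompletionMap (L := L) (IsCMField.complexConj L) hw) (placeForm (Matrix.of fun i j : Fin 2 => if i.val + j.val + 1 = 2 then (1 : L) else 0) w.1))) (huη : (((uη : ↥(unitaryGroupOfForm (galAdicCompletionMap (L := L) (IsCMField.complexConj L) hw) (placeForm (Matrix.of fun i j : Fin 2 => if i.val + j.val + 1 = 2 then (1 : L) else 0) w.1))) : GL (Fin 2) (w.1.adicCompletion L)) : Matrix (Fin 2) (Fin 2) (w.1.adicCompletion L)) = Matrix.diagonal ![(ηE : (w.1.adicCompletion L)), ((galAdicCompletionMap (L := L) (IsCMField.complexConj L) hw) (ηE : (w.1.adicCompletion L)))⁻¹])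
    -- the abstract coordinates of the HEAD's front half
    (mfl j R : ℕ) (ζ : ↥(Subgroup.centralizer ({t₀} : Set ((cmDatum L 2 (Matrix.of fun i j : Fin 2 => if i.val + j.val + 1 = 2 then (1 : L) else 0)).Local v × (cmDatum L 1 (Matrix.of fun i j : Fin 1 => if i.val + j.val + 1 = 1 then (1 : L) else 0)).Local v))) → (w.1.adicCompletion L)) (β : ↥(Subgroup.centralizer ({t₀} : Set ((cmDatum L 2 (Matrix.of fun i j : Fin 2 => if i.val + j.val + 1 = 2 then (1 : L) else 0)).Local v × (cmDatum L 1 (Matrix.of fun i j : Fin 1 => if i.val + j.val + 1 = 1 then (1 : L) else 0)).Local v))) → (v.adicCompletion ↥(maximalRealSubfield L))) (oT : ↥(Subgroup.centralizer ({t₀} : Set ((cmDatum L 2 (Matrix.of fun i j : Fin 2 => if i.val + j.val + 1 = 2 then (1 : L) else 0)).Local v × (cmDatum L 1 (Matrix.of fun i j : Fin 1 => if i.val + j.val + 1 = 1 then (1 : L) else 0)).Local v))) → ℕ) (κT : ↥(Subgroup.centralizer ({t₀} : Set ((cmDatum L 2 (Matrix.of fun i j : Fin 2 => if i.val + j.val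 + 1 = 2 then (1 : L) else 0)).Local v × (cmDatum L 1 (Matrix.of fun i j : Fin 1 => if i.val + j.val + 1 = 1 then (1 : L) else 0)).Local v))) → ℂ)
    (hnf : ∀ t : ↥(Subgroup.centralizer ({t₀} : Set ((cmDatum L 2 (Matrix.of fun i j : Fin 2 => if i.val + j.val + 1 = 2 then (1 : L) else 0)).Local v × (cmDatum L 1 (Matrix.of fun i j : Fin 1 => if i.val + j.val + 1 = 1 then (1 : L) else 0)).Local v))), ((((E₂ (t : ((cmDatum L 2 (Matrix.of fun i j : Fin 2 => if i.val + j.val + 1 = 2 then (1 : L) else 0)).Local v × (cmDatum L 1 (Matrix.of fun i j : Fin 1 => if i.val + j.val + 1 = 1 then (1 : L) else 0)).Local v)).1) : ↥(unitaryGroupOfForm (galAdicCompletionMap (L := L) (IsCMField.complexConj L) hw) (placeForm (Matrix.of fun i j : Fin 2 => if i.val + j.val + 1 = 2 then (1 : L) else 0) w.1))) : GL (Fin 2) (w.1.adicCompletion L)) : Matrix (Fin 2) (Fin 2) (w.1.adicCompletion L)) 0 0 ≠ 0 →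
      Matrix.diagonal ![1, α] * ((((E₂ (t : ((cmDatum L 2 (Matrix.of fun i j : Fin 2 => if i.val + j.val + 1 = 2 then (1 : L) else 0)).Local v × (cmDatum L 1 (Matrix.of fun i j : Fin 1 => if i.val + j.val + 1 = 1 then (1 : L) else 0)).Local v)).1) : ↥(unitaryGroupOfForm (galAdicCompletionMap (L := L) (IsCMField.complexConj L) hw) (placeForm (Matrix.of fun i j : Fin 2 => if i.val + j.val + 1 = 2 then (1 : L) else 0) w.1))) : GL (Fin 2) (w.1.adicCompletion L)) : Matrix (Fin 2) (Fin 2) (w.1.adicCompletion L)) * Matrix.diagonal ![1, α⁻¹] = ζ t • (!![(1 : (v.adicCompletion ↥(maximalRealSubfield L))), β t * v₀; β t, 1 + β t * u₀]).map (toPlace v w))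
    (h00 : ∀ t : ↥(Subgroup.centralizer ({t₀} : Set ((cmDatum L 2 (Matrix.of fun i j : Fin 2 => if i.val + j.val + 1 = 2 then (1 : L) else 0)).Local v × (cmDatum L 1 (Matrix.of fun i j : Fin 1 => if i.val + j.val + 1 = 1 then (1 : L) else 0)).Local v))), t ∈ {t : ↥(Subgroup.centralizer ({t₀} : Set ((cmDatum L 2 (Matrix.of fun i j : Fin 2 => if i.val + j.val + 1 = 2 then (1 : L) else 0)).Local v × (cmDatum L 1 (Matrix.of fun i j : Fin 1 => if i.val + j.val + 1 = 1 then (1 : L) else 0)).Local v))) | IsRegularElt ((t : ((cmDatum L 2 (Matrix.of fun i j : Fin 2 => if i.val + j.val + 1 = 2 then (1 : L) else 0)).Local v × (cmDatum L 1 (Matrix.of fun i j : Fin 1 => if i.val + j.val + 1 = 1 then (1 : L) else 0)).Local v)).1.val : GL (Fin 2) (LocalRing L v))} → mfl ≤ (-WithZero.log (Valued.v ((((P⁻¹).val * ((t : ((cmDatum L 2 (Matrix.of fun i j : Fin 2 => if i.val + j.val + 1 = 2 then (1 : L) else 0)).Local v × (cmDatum L 1 (Matrix.of fun i j : Fin 1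 => if i.val + j.val + 1 = 1 then (1 : L) else 0)).Local v)).1.val.val : Matrix (Fin 2) (Fin 2) (LocalRing L v)) * P.val) 0 0 - ((P⁻¹).val * ((t : ((cmDatum L 2 (Matrix.of fun i j : Fin 2 => if i.val + j.val + 1 = 2 then (1 : L) else 0)).Local v × (cmDatum L 1 (Matrix.of fun i j : Fin 1 => if i.val + j.val + 1 = 1 then (1 : L) else 0)).Local v)).1.val.val : Matrix (Fin 2) (Fin 2) (LocalRing L v)) * P.val) 1 1) w))).toNat → ((((E₂ (t : ((cmDatum L 2 (Matrix.of fun i j : Fin 2 => if i.val + j.val + 1 = 2 then (1 : L) else 0)).Local v × (cmDatum L 1 (Matrix.of fun i j : Fin 1 => if i.val + j.val + 1 = 1 then (1 : L) else 0)).Local v)).1) : ↥(unitaryGroupOfForm (galAdicCompletionMap (L := L) (IsCMField.complexConj L) hw) (placeForm (Matrix.of fun i j : Fin 2 => if i.val + j.val + 1 = 2 then (1 : L) else 0) w.1))) : GL (Fin 2) (w.1.adicCompletion L)) : Matrix (Fin 2) (Fin 2) (w.1.adicCompletion L)) 0 0 ≠ 0)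
    (hoT : ∀ t : ↥(Subgroup.centralizer ({t₀} : Set ((cmDatum L 2 (Matrix.of fun i j : Fin 2 => if i.val + j.val + 1 = 2 then (1 : L) else 0)).Local v × (cmDatum L 1 (Matrix.of fun i j : Fin 1 => if i.val + j.val + 1 = 1 then (1 : L) else 0)).Local v))), t ∈ {t : ↥(Subgroup.centralizer ({t₀} : Set ((cmDatum L 2 (Matrix.of fun i j : Fin 2 => if i.val + j.val + 1 = 2 then (1 : L) else 0)).Local v × (cmDatum L 1 (Matrix.of fun i j : Fin 1 => if i.val + j.val + 1 = 1 then (1 : L) else 0)).Local v))) | IsRegularElt ((t : ((cmDatum L 2 (Matrix.of fun i j : Fin 2 => if i.val + j.val + 1 = 2 then (1 : L) else 0)).Local v × (cmDatum L 1 (Matrix.of fun i j : Fin 1 => if i.val + j.val + 1 = 1 then (1 : L) else 0)).Local v)).1.val : GL (Fin 2) (LocalRing L v))} → mfl ≤ (-WithZero.log (Valued.v ((((P⁻¹).val * ((t : ((cmDatum L 2 (Matrix.of fun i j : Fin 2 => if i.val + j.val + 1 = 2 then (1 : L) else 0)).Local v × (cmDatum L 1 (Matrix.of fun i j : Fin 1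 => if i.val + j.val + 1 = 1 then (1 : L) else 0)).Local v)).1.val.val : Matrix (Fin 2) (Fin 2) (LocalRing L v)) * P.val) 0 0 - ((P⁻¹).val * ((t : ((cmDatum L 2 (Matrix.of fun i j : Fin 2 => if i.val + j.val + 1 = 2 then (1 : L) else 0)).Local v × (cmDatum L 1 (Matrix.of fun i j : Fin 1 => if i.val + j.val + 1 = 1 then (1 : L) else 0)).Local v)).1.val.val : Matrix (Fin 2) (Fin 2) (LocalRing L v)) * P.val) 1 1) w))).toNat → j ≤ oT t ∧ Valued.v (β t) = WithZero.exp (-(oT t : ℤ)))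
    (hκT : ∀ t : ↥(Subgroup.centralizer ({t₀} : Set ((cmDatum L 2 (Matrix.of fun i j : Fin 2 => if i.val + j.val + 1 = 2 then (1 : L) else 0)).Local v × (cmDatum L 1 (Matrix.of fun i j : Fin 1 => if i.val + j.val + 1 = 1 then (1 : L) else 0)).Local v))), t ∈ {t : ↥(Subgroup.centralizer ({t₀} : Set ((cmDatum L 2 (Matrix.of fun i j : Fin 2 => if i.val + j.val + 1 = 2 then (1 : L) else 0)).Local v × (cmDatum L 1 (Matrix.of fun i j : Fin 1 => if i.val + j.val + 1 = 1 then (1 : L) else 0)).Local v))) | IsRegularElt ((t : ((cmDatum L 2 (Matrix.of fun i j : Fin 2 => if i.val + j.val + 1 = 2 then (1 : L) else 0)).Local v × (cmDatum L 1 (Matrix.of fun i j : Fin 1 => if i.val + j.val + 1 = 1 then (1 : L) else 0)).Local v)).1.val : GL (Fin 2) (LocalRing L v))} → mfl ≤ (-WithZero.log (Valued.v ((((P⁻¹).val * ((t : ((cmDatum L 2 (Matrix.of fun i j : Fin 2 => if i.val + j.val + 1 = 2 then (1 : L) else 0)).Local v × (cmDatum L 1 (Matrix.of fun i j : Fin 1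 => if i.val + j.val + 1 = 1 then (1 : L) else 0)).Local v)).1.val.val : Matrix (Fin 2) (Fin 2) (LocalRing L v)) * P.val) 0 0 - ((P⁻¹).val * ((t : ((cmDatum L 2 (Matrix.of fun i j : Fin 2 => if i.val + j.val + 1 = 2 then (1 : L) else 0)).Local v × (cmDatum L 1 (Matrix.of fun i j : Fin 1 => if i.val + j.val + 1 = 1 then (1 : L) else 0)).Local v)).1.val.val : Matrix (Fin 2) (Fin 2) (LocalRing L v)) * P.val) 1 1) w))).toNat → κT t = ((hilbertSymbol (v.adicCompletion ↥(maximalRealSubfield L)) (β t) (algebraMap ↥(maximalRealSubfield L) (v.adicCompletion ↥(maximalRealSubfield L)) ((cmQuadraticGenerator L : 𝓞 ↥(maximalRealSubfield L)) : ↥(maximalRealSubfield L))) : ℤ) : ℂ)) :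
    ∃ (Φ ΦD : ℕ → ↥(Subgroup.centralizer ({t₀} : Set ((cmDatum L 2 (Matrix.of fun i j : Fin 2 => if i.val + j.val + 1 = 2 then (1 : L) else 0)).Local v × (cmDatum L 1 (Matrix.of fun i j : Fin 1 => if i.val + j.val + 1 = 1 then (1 : L) else 0)).Local v))) → ℂ) (Nf NDf : ℕ → ↥(Subgroup.centralizer ({t₀} : Set ((cmDatum L 2 (Matrix.of fun i j : Fin 2 => if i.val + j.val + 1 = 2 then (1 : L) else 0)).Local v × (cmDatum L 1 (Matrix.of fun i j : Fin 1 => if i.val + j.val + 1 = 1 then (1 : L) else 0)).Local v))) → ((cmDatum L 2 (Matrix.of fun i j : Fin 2 => if i.val + j.val + 1 = 2 then (1 : L) else 0)).Local v × (cmDatum L 1 (Matrix.of fun i j : Fin 1 => if i.val + j.val + 1 = 1 then (1 : L) else 0)).Local v)),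
      (∀ t : ↥(Subgroup.centralizer ({t₀} : Set ((cmDatum L 2 (Matrix.of fun i j : Fin 2 => if i.val + j.val + 1 = 2 then (1 : L) else 0)).Local v × (cmDatum L 1 (Matrix.of fun i j : Fin 1 => if i.val + j.val + 1 = 1 then (1 : L) else 0)).Local v))), t ∈ {t : ↥(Subgroup.centralizer ({t₀} : Set ((cmDatum L 2 (Matrix.of fun i j : Fin 2 => if i.val + j.val + 1 = 2 then (1 : L) else 0)).Local v × (cmDatum L 1 (Matrix.of fun i j : Fin 1 => if i.val + j.val + 1 = 1 then (1 : L) else 0)).Local v))) | IsRegularElt ((t : ((cmDatum L 2 (Matrix.of fun i j : Fin 2 => if i.val + j.val + 1 = 2 then (1 : L) else 0)).Local v × (cmDatum L 1 (Matrix.of fun i j : Fin 1 => if i.val + j.val + 1 = 1 then (1 : L) else 0)).Local v)).1.val : GL (Fin 2) (LocalRing L v))} → mfl ≤ (-WithZero.log (Valued.v ((((P⁻¹).val * ((t : ((cmDatum L 2 (Matrix.of fun i j : Fin 2 => if i.val + j.val + 1 = 2 then (1 : L) else 0)).Local v × (cmDatum L 1 (Matrix.of fun i j : Fin 1 => if i.val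 + j.val + 1 = 1 then (1 : L) else 0)).Local v)).1.val.val : Matrix (Fin 2) (Fin 2) (LocalRing L v)) * P.val) 0 0 - ((P⁻¹).val * ((t : ((cmDatum L 2 (Matrix.of fun i j : Fin 2 => if i.val + j.val + 1 = 2 then (1 : L) else 0)).Local v × (cmDatum L 1 (Matrix.of fun i j : Fin 1 => if i.val + j.val + 1 = 1 then (1 : L) else 0)).Local v)).1.val.val : Matrix (Fin 2) (Fin 2) (LocalRing L v)) * P.val) 1 1) w))).toNat → ∀ i ∈ Finset.range (j + R + 1), (∫ k in (((K).prod (⊤ : Subgroup ((cmDatum L 1 (Matrix.of fun i j : Fin 1 => if i.val + j.val + 1 = 1 then (1 : L) else 0)).Local v)) : Subgroup ((cmDatum L 2 (Matrix.of fun i j : Fin 2 => if i.val + j.val + 1 = 2 then (1 : L) else 0)).Local v × (cmDatum L 1 (Matrix.of fun i j : Fin 1 => if i.val + j.val + 1 = 1 then (1 : L) else 0)).Local v)) : Set ((cmDatum L 2 (Matrix.of fun i j : Fin 2 => if i.val + j.val + 1 = 2 then (1 : L) else 0)).Local v × (cmDatum L 1 (Matrix.of fun i j : Fin 1 => if i.val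 + j.val + 1 = 1 then (1 : L) else 0)).Local v)), f (k⁻¹ * (((E₂.symm (uη⁻¹ ^ (oT t - j + i)), (1 : (cmDatum L 1 (Matrix.of fun i j : Fin 1 => if i.val + j.val + 1 = 1 then (1 : L) else 0)).Local v)) : ((cmDatum L 2 (Matrix.of fun i j : Fin 2 => if i.val + j.val + 1 = 2 then (1 : L) else 0)).Local v × (cmDatum L 1 (Matrix.of fun i j : Fin 1 => if i.val + j.val + 1 = 1 then (1 : L) else 0)).Local v))⁻¹ * ((t : ((cmDatum L 2 (Matrix.of fun i j : Fin 2 => if i.val + j.val + 1 = 2 then (1 : L) else 0)).Local v × (cmDatum L 1 (Matrix.of fun i j : Fin 1 => if i.val + j.val + 1 = 1 then (1 : L) else 0)).Local v))) * (E₂.symm (uη⁻¹ ^ (oT t - j + i)), 1)) * k) ∂ν) - (∫ k in (((K).prod (⊤ : Subgroup ((cmDatum L 1 (Matrix.of fun i j : Fin 1 => if i.val + j.val + 1 = 1 then (1 : L) else 0)).Local v)) : Subgroup ((cmDatum L 2 (Matrix.of fun i j : Fin 2 => if i.val + j.val + 1 = 2 then (1 : L) else 0)).Local v × (cmDatum L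 1 (Matrix.of fun i j : Fin 1 => if i.val + j.val + 1 = 1 then (1 : L) else 0)).Local v)) : Set ((cmDatum L 2 (Matrix.of fun i j : Fin 2 => if i.val + j.val + 1 = 2 then (1 : L) else 0)).Local v × (cmDatum L 1 (Matrix.of fun i j : Fin 1 => if i.val + j.val + 1 = 1 then (1 : L) else 0)).Local v)), f (k⁻¹ * (((E₂.symm (uη⁻¹ ^ (oT t - j + i)), (1 : (cmDatum L 1 (Matrix.of fun i j : Fin 1 => if i.val + j.val + 1 = 1 then (1 : L) else 0)).Local v)) : ((cmDatum L 2 (Matrix.of fun i j : Fin 2 => if i.val + j.val + 1 = 2 then (1 : L) else 0)).Local v × (cmDatum L 1 (Matrix.of fun i j : Fin 1 => if i.val + j.val + 1 = 1 then (1 : L) else 0)).Local v))⁻¹ * (e (t : ((cmDatum L 2 (Matrix.of fun i j : Fin 2 => if i.val + j.val + 1 = 2 then (1 : L) else 0)).Local v × (cmDatum L 1 (Matrix.of fun i j : Fin 1 => if i.val + j.val + 1 = 1 then (1 : L) else 0)).Local v))) * (E₂.symm (uη⁻¹ ^ (oT t - j + i)), 1)) * k) ∂ν) = κT t * (Φ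 i t - ΦD i t)) ∧
      (∀ i t, Φ i t = ∫ k in (((K).prod (⊤ : Subgroup ((cmDatum L 1 (Matrix.of fun i j : Fin 1 => if i.val + j.val + 1 = 1 then (1 : L) else 0)).Local v)) : Subgroup ((cmDatum L 2 (Matrix.of fun i j : Fin 2 => if i.val + j.val + 1 = 2 then (1 : L) else 0)).Local v × (cmDatum L 1 (Matrix.of fun i j : Fin 1 => if i.val + j.val + 1 = 1 then (1 : L) else 0)).Local v)) : Set ((cmDatum L 2 (Matrix.of fun i j : Fin 2 => if i.val + j.val + 1 = 2 then (1 : L) else 0)).Local v × (cmDatum L 1 (Matrix.of fun i j : Fin 1 => if i.val + j.val + 1 = 1 then (1 : L) else 0)).Local v)), f (k⁻¹ * Nf i t * k) ∂ν) ∧ (∀ i t, ΦD i t = ∫ k in (((K).prod (⊤ : Subgroup ((cmDatum L 1 (Matrix.of fun i j : Fin 1 => if i.val + j.val + 1 = 1 then (1 : L) else 0)).Local v)) : Subgroup ((cmDatum L 2 (Matrix.of fun i j : Fin 2 => if i.val + j.val + 1 = 2 then (1 : L) else 0)).Local v × (cmDatum L 1 (Matrix.of fun i j : Fin 1 => if i.val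 + j.val + 1 = 1 then (1 : L) else 0)).Local v)) : Set ((cmDatum L 2 (Matrix.of fun i j : Fin 2 => if i.val + j.val + 1 = 2 then (1 : L) else 0)).Local v × (cmDatum L 1 (Matrix.of fun i j : Fin 1 => if i.val + j.val + 1 = 1 then (1 : L) else 0)).Local v)), f (k⁻¹ * NDf i t * k) ∂ν) ∧
      (∀ i ∈ Finset.range (j + R + 1), ∀ s : ↥(Subgroup.centralizer ({t₀} : Set ((cmDatum L 2 (Matrix.of fun i j : Fin 2 => if i.val + j.val + 1 = 2 then (1 : L) else 0)).Local v × (cmDatum L 1 (Matrix.of fun i j : Fin 1 => if i.val + j.val + 1 = 1 then (1 : L) else 0)).Local v))), ¬ IsRegularElt ((s : ((cmDatum L 2 (Matrix.of fun i j : Fin 2 => if i.val + j.val + 1 = 2 then (1 : L) else 0)).Local v × (cmDatum L 1 (Matrix.of fun i j : Fin 1 => if i.val + j.val + 1 = 1 then (1 : L) else 0)).Local v)).1.val : GL (Fin 2) (LocalRing L v)) → ContinuousAt (Nf i) s ∧ ContinuousAt (NDf i) s) := by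
  classical
  haveI : IsDiscreteValuationRing 𝒪[(v.adicCompletion ↥(maximalRealSubfield L))] := isDiscreteValuationRing_integer_of_compatible hϖF
  -- §0 data at the place: the non-norm unit `u_F` below `u`, the norm uniformiser `c = N(ηE)`
  obtain ⟨uF, huF0, huF1, hu, huu⟩ := exists_unit_toPlace_eq_of_not_exists_norm L v w hw u hvu hσu hun
  obtain ⟨c, hc0, hc, hvc⟩ := exists_uniformizer_toPlace_eq_mul L v w hw he ηE hηE
  have hη0 : (ηE : (w.1.adicCompletion L)) ≠ 0 := ηE.ne_zero
  -- the explicit window matrices (★ V2's normal forms), as opaque functions with their defining equations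
  obtain ⟨MA, hMA⟩ : ∃ MA : ℕ → ↥(Subgroup.centralizer ({t₀} : Set ((cmDatum L 2 (Matrix.of fun i j : Fin 2 => if i.val + j.val + 1 = 2 then (1 : L) else 0)).Local v × (cmDatum L 1 (Matrix.of fun i j : Fin 1 => if i.val + j.val + 1 = 1 then (1 : L) else 0)).Local v))) → Matrix (Fin 2) (Fin 2) (w.1.adicCompletion L), ∀ i t, MA i t =
      Matrix.diagonal ![1, α⁻¹] * (ζ t • (!![(1 : (v.adicCompletion ↥(maximalRealSubfield L))), v₀ * c ^ i * (c ^ j)⁻¹ * β t ^ 2; c ^ j * (c ^ i)⁻¹, 1 + β t * u₀]).map (toPlace v w)) * Matrix.diagonal ![1, α] :=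
    ⟨_, fun _ _ => rfl⟩
  obtain ⟨MB, hMB⟩ : ∃ MB : ℕ → ↥(Subgroup.centralizer ({t₀} : Set ((cmDatum L 2 (Matrix.of fun i j : Fin 2 => if i.val + j.val + 1 = 2 then (1 : L) else 0)).Local v × (cmDatum L 1 (Matrix.of fun i j : Fin 1 => if i.val + j.val + 1 = 1 then (1 : L) else 0)).Local v))) → Matrix (Fin 2) (Fin 2) (w.1.adicCompletion L), ∀ i t, MB i t =
      Matrix.diagonal ![1, α⁻¹] * (ζ t • (!![(1 : (v.adicCompletion ↥(maximalRealSubfield L))), v₀ * c ^ i * (c ^ j)⁻¹ * uF⁻¹ * β t ^ 2; c ^ j * (c ^ i)⁻¹ * uF, 1 + β t * u₀]).map (toPlace v w)) * Matrix.diagonal ![1, α] :=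
    ⟨_, fun _ _ => rfl⟩
  -- the window ELEMENTS of `U_w`: the unitary element with that matrix where there is one, `1` elsewhere
  obtain ⟨XA, hXA⟩ : ∃ XA : ℕ → ↥(Subgroup.centralizer ({t₀} : Set ((cmDatum L 2 (Matrix.of fun i j : Fin 2 => if i.val + j.val + 1 = 2 then (1 : L) else 0)).Local v × (cmDatum L 1 (Matrix.of fun i j : Fin 1 => if i.val + j.val + 1 = 1 then (1 : L) else 0)).Local v))) → ↥(unitaryGroupOfForm (galAdicCompletionMap (L := L) (IsCMField.complexConj L) hw) (placeForm (Matrix.of fun i j : Fin 2 => if i.val + j.val + 1 = 2 then (1 : L) else 0) w.1)), ∀ i t, (∃ X : ↥(unitaryGroupOfForm (galAdicCompletionMap (L := L) (IsCMField.complexConj L) hw) (placeForm (Matrix.of fun i j : Fin 2 => if i.val + j.val + 1 = 2 then (1 : L) else 0) w.1)), (((X : ↥(unitaryGroupOfForm (galAdicCompletionMap (L := L) (IsCMField.complexConj L) hw) (placeForm (Matrix.of fun i j : Fin 2 => if i.val + j.val + 1 = 2 then (1 : L) else 0) w.1))) : GL (Fin 2) (w.1.adicCompletion L)) : Matrix (Fin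 2) (Fin 2) (w.1.adicCompletion L)) = MA i t) →
      (((XA i t : ↥(unitaryGroupOfForm (galAdicCompletionMap (L := L) (IsCMField.complexConj L) hw) (placeForm (Matrix.of fun i j : Fin 2 => if i.val + j.val + 1 = 2 then (1 : L) else 0) w.1))) : GL (Fin 2) (w.1.adicCompletion L)) : Matrix (Fin 2) (Fin 2) (w.1.adicCompletion L)) = MA i t :=
    ⟨fun i t => if h : ∃ X : ↥(unitaryGroupOfForm (galAdicCompletionMap (L := L) (IsCMField.complexConj L) hw) (placeForm (Matrix.of fun i j : Fin 2 => if i.val + j.val + 1 = 2 then (1 : L) else 0) w.1)), (((X : ↥(unitaryGroupOfForm (galAdicCompletionMap (L := L) (IsCMField.complexConj L) hw) (placeForm (Matrix.of fun i j : Fin 2 => if i.val + j.val + 1 = 2 then (1 : L) else 0) w.1))) : GL (Fin 2) (w.1.adicCompletion L)) : Matrix (Fin 2) (Fin 2) (w.1.adicCompletion L)) = MA i t then h.choose else 1,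
      fun i t h => by simp only [dif_pos h]; exact h.choose_spec⟩
  obtain ⟨XB, hXB⟩ : ∃ XB : ℕ → ↥(Subgroup.centralizer ({t₀} : Set ((cmDatum L 2 (Matrix.of fun i j : Fin 2 => if i.val + j.val + 1 = 2 then (1 : L) else 0)).Local v × (cmDatum L 1 (Matrix.of fun i j : Fin 1 => if i.val + j.val + 1 = 1 then (1 : L) else 0)).Local v))) → ↥(unitaryGroupOfForm (galAdicCompletionMap (L := L) (IsCMField.complexConj L) hw) (placeForm (Matrix.of fun i j : Fin 2 => if i.val + j.val + 1 = 2 then (1 : L) else 0) w.1)), ∀ i t, (∃ X : ↥(unitaryGroupOfForm (galAdicCompletionMap (L := L) (IsCMField.complexConj L) hw) (placeForm (Matrix.of fun i j : Fin 2 => if i.val + j.val + 1 = 2 then (1 : L) else 0) w.1)), (((X : ↥(unitaryGroupOfForm (galAdicCompletionMap (L := L) (IsCMField.complexConj L) hw) (placeForm (Matrix.of fun i j : Fin 2 => if i.val + j.val + 1 = 2 then (1 : L) else 0) w.1))) : GL (Fin 2) (w.1.adicCompletion L)) : Matrix (Fin 2) (Fin 2) (w.1.adicCompletion L)) = MB i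 t) →
      (((XB i t : ↥(unitaryGroupOfForm (galAdicCompletionMap (L := L) (IsCMField.complexConj L) hw) (placeForm (Matrix.of fun i j : Fin 2 => if i.val + j.val + 1 = 2 then (1 : L) else 0) w.1))) : GL (Fin 2) (w.1.adicCompletion L)) : Matrix (Fin 2) (Fin 2) (w.1.adicCompletion L)) = MB i t :=
    ⟨fun i t => if h : ∃ X : ↥(unitaryGroupOfForm (galAdicCompletionMap (L := L) (IsCMField.complexConj L) hw) (placeForm (Matrix.of fun i j : Fin 2 => if i.val + j.val + 1 = 2 then (1 : L) else 0) w.1)), (((X : ↥(unitaryGroupOfForm (galAdicCompletionMap (L := L) (IsCMField.complexConj L) hw) (placeForm (Matrix.of fun i j : Fin 2 => if i.val + j.val + 1 = 2 then (1 : L) else 0) w.1))) : GL (Fin 2) (w.1.adicCompletion L)) : Matrix (Fin 2) (Fin 2) (w.1.adicCompletion L)) = MB i t then h.choose else 1,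
      fun i t h => by simp only [dif_pos h]; exact h.choose_spec⟩
  -- the window matrices ARE unitary wherever the corner `(X_t)₀₀` is non-zero (`σ(ζ)ζ·ι det = 1` from `X_t ∈ U_w`)
  have hmemA : ∀ (i : ℕ) (t : ↥(Subgroup.centralizer ({t₀} : Set ((cmDatum L 2 (Matrix.of fun i j : Fin 2 => if i.val + j.val + 1 = 2 then (1 : L) else 0)).Local v × (cmDatum L 1 (Matrix.of fun i j : Fin 1 => if i.val + j.val + 1 = 1 then (1 : L) else 0)).Local v)))), ((((E₂ (t : ((cmDatum L 2 (Matrix.of fun i j : Fin 2 => if i.val + j.val + 1 = 2 then (1 : L) else 0)).Local v × (cmDatum L 1 (Matrix.of fun i j : Fin 1 => if i.val + j.val + 1 = 1 then (1 : L) else 0)).Local v)).1) : ↥(unitaryGroupOfForm (galAdicCompletionMap (L := L) (IsCMField.complexConj L) hw) (placeForm (Matrix.of fun i j : Fin 2 => if i.val + j.val + 1 = 2 then (1 : L) else 0) w.1))) : GL (Fin 2) (w.1.adicCompletion L)) : Matrix (Fin 2) (Fin 2) (w.1.adicCompletion L)) 0 0 ≠ 0 → ∃ X : ↥(unitaryGroupOfForm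 (galAdicCompletionMap (L := L) (IsCMField.complexConj L) hw) (placeForm (Matrix.of fun i j : Fin 2 => if i.val + j.val + 1 = 2 then (1 : L) else 0) w.1)), (((X : ↥(unitaryGroupOfForm (galAdicCompletionMap (L := L) (IsCMField.complexConj L) hw) (placeForm (Matrix.of fun i j : Fin 2 => if i.val + j.val + 1 = 2 then (1 : L) else 0) w.1))) : GL (Fin 2) (w.1.adicCompletion L)) : Matrix (Fin 2) (Fin 2) (w.1.adicCompletion L)) = MA i t := by
    intro i t h0
    have h1 := map_mul_mul_map_det_eq_one_of_coe_descent L v w hw hα hα0 (E₂ (t : ((cmDatum L 2 (Matrix.of fun i j : Fin 2 => if i.val + j.val + 1 = 2 then (1 : L) else 0)).Local v × (cmDatum L 1 (Matrix.of fun i j : Fin 1 => if i.val + j.val + 1 = 1 then (1 : L) else 0)).Local v)).1) (hnf t h0)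
    rw [← det_windowA_eq hc0 i j (β t) u₀ v₀] at h1
    obtain ⟨X, hX⟩ := exists_coe_eq_descentForm_of_det L v w hw hα hα0 h1
    exact ⟨X, by rw [hX, hMA]⟩
  have hmemB : ∀ (i : ℕ) (t : ↥(Subgroup.centralizer ({t₀} : Set ((cmDatum L 2 (Matrix.of fun i j : Fin 2 => if i.val + j.val + 1 = 2 then (1 : L) else 0)).Local v × (cmDatum L 1 (Matrix.of fun i j : Fin 1 => if i.val + j.val + 1 = 1 then (1 : L) else 0)).Local v)))), ((((E₂ (t : ((cmDatum L 2 (Matrix.of fun i j : Fin 2 => if i.val + j.val + 1 = 2 then (1 : L) else 0)).Local v × (cmDatum L 1 (Matrix.of fun i j : Fin 1 => if i.val + j.val + 1 = 1 then (1 : L) else 0)).Local v)).1) : ↥(unitaryGroupOfForm (galAdicCompletionMap (L := L) (IsCMField.complexConj L) hw) (placeForm (Matrix.of fun i j : Fin 2 => if i.val + j.val + 1 = 2 then (1 : L) else 0) w.1))) : GL (Fin 2) (w.1.adicCompletion L)) : Matrix (Fin 2) (Fin 2) (w.1.adicCompletion L)) 0 0 ≠ 0 → ∃ X : ↥(unitaryGroupOfForm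 (galAdicCompletionMap (L := L) (IsCMField.complexConj L) hw) (placeForm (Matrix.of fun i j : Fin 2 => if i.val + j.val + 1 = 2 then (1 : L) else 0) w.1)), (((X : ↥(unitaryGroupOfForm (galAdicCompletionMap (L := L) (IsCMField.complexConj L) hw) (placeForm (Matrix.of fun i j : Fin 2 => if i.val + j.val + 1 = 2 then (1 : L) else 0) w.1))) : GL (Fin 2) (w.1.adicCompletion L)) : Matrix (Fin 2) (Fin 2) (w.1.adicCompletion L)) = MB i t := by
    intro i t h0
    have h1 := map_mul_mul_map_det_eq_one_of_coe_descent L v w hw hα hα0 (E₂ (t : ((cmDatum L 2 (Matrix.of fun i j : Fin 2 => if i.val + j.val + 1 = 2 then (1 : L) else 0)).Local v × (cmDatum L 1 (Matrix.of fun i j : Fin 1 => if i.val + j.val + 1 = 1 then (1 : L) else 0)).Local v)).1) (hnf t h0)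
    rw [← det_windowB_eq hc0 huF0 i j (β t) u₀ v₀] at h1
    obtain ⟨X, hX⟩ := exists_coe_eq_descentForm_of_det L v w hw hα hα0 h1
    exact ⟨X, by rw [hX, hMB]⟩
  -- THE WITNESSES: `Nf i t := (E₂⁻¹ X_A(i,t), t₂)`, `Φ i t := F̄(X_A(i,t), t₂)`, and the `B`-versions
  refine ⟨fun i t => ∫ k in (((K).prod (⊤ : Subgroup ((cmDatum L 1 (Matrix.of fun i j : Fin 1 => if i.val + j.val + 1 = 1 then (1 : L) else 0)).Local v)) : Subgroup ((cmDatum L 2 (Matrix.of fun i j : Fin 2 => if i.val + j.val + 1 = 2 then (1 : L) else 0)).Local v × (cmDatum L 1 (Matrix.of fun i j : Fin 1 => if i.val + j.val + 1 = 1 then (1 : L) else 0)).Local v)) : Set ((cmDatum L 2 (Matrix.of fun i j : Fin 2 => if i.val + j.val + 1 = 2 then (1 : L) else 0)).Local v × (cmDatum L 1 (Matrix.of fun i j : Fin 1 => if i.val + j.val + 1 = 1 then (1 : L) else 0)).Local v)), f (k⁻¹ * ((E₂.symm (XA i t), (t : ((cmDatum L 2 (Matrix.of fun i j : Fin 2 =>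 if i.val + j.val + 1 = 2 then (1 : L) else 0)).Local v × (cmDatum L 1 (Matrix.of fun i j : Fin 1 => if i.val + j.val + 1 = 1 then (1 : L) else 0)).Local v)).2) : ((cmDatum L 2 (Matrix.of fun i j : Fin 2 => if i.val + j.val + 1 = 2 then (1 : L) else 0)).Local v × (cmDatum L 1 (Matrix.of fun i j : Fin 1 => if i.val + j.val + 1 = 1 then (1 : L) else 0)).Local v)) * k) ∂ν,
    fun i t => ∫ k in (((K).prod (⊤ : Subgroup ((cmDatum L 1 (Matrix.of fun i j : Fin 1 => if i.val + j.val + 1 = 1 then (1 : L) else 0)).Local v)) : Subgroup ((cmDatum L 2 (Matrix.of fun i j : Fin 2 => if i.val + j.val + 1 = 2 then (1 : L) else 0)).Local v × (cmDatum L 1 (Matrix.of fun i j : Fin 1 => if i.val + j.val + 1 = 1 then (1 : L) else 0)).Local v)) : Set ((cmDatum L 2 (Matrix.of fun i j : Fin 2 => if i.val + j.val + 1 = 2 then (1 : L) else 0)).Local v × (cmDatum L 1 (Matrix.of fun i j : Fin 1 => if i.val + j.val + 1 = 1 then (1 : L) else 0)).Local v)), f (k⁻¹ * ((E₂.symm (XB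 i t), (t : ((cmDatum L 2 (Matrix.of fun i j : Fin 2 => if i.val + j.val + 1 = 2 then (1 : L) else 0)).Local v × (cmDatum L 1 (Matrix.of fun i j : Fin 1 => if i.val + j.val + 1 = 1 then (1 : L) else 0)).Local v)).2) : ((cmDatum L 2 (Matrix.of fun i j : Fin 2 => if i.val + j.val + 1 = 2 then (1 : L) else 0)).Local v × (cmDatum L 1 (Matrix.of fun i j : Fin 1 => if i.val + j.val + 1 = 1 then (1 : L) else 0)).Local v)) * k) ∂ν,
    fun i t => ((E₂.symm (XA i t), (t : ((cmDatum L 2 (Matrix.of fun i j : Fin 2 => if i.val + j.val + 1 = 2 then (1 : L) else 0)).Local v × (cmDatum L 1 (Matrix.of fun i j : Fin 1 => if i.val + j.val + 1 = 1 then (1 : L) else 0)).Local v)).2) : ((cmDatum L 2 (Matrix.of fun i j : Fin 2 => if i.val + j.val + 1 = 2 then (1 : L) else 0)).Local v × (cmDatum L 1 (Matrix.of fun i j : Fin 1 => if i.val + j.val + 1 = 1 then (1 : L) else 0)).Local v)), fun i t => ((E₂.symm (XB i t), (t : ((cmDatum L 2 (Matrix.of fun i j : Fin 2 => if i.val + j.val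 + 1 = 2 then (1 : L) else 0)).Local v × (cmDatum L 1 (Matrix.of fun i j : Fin 1 => if i.val + j.val + 1 = 1 then (1 : L) else 0)).Local v)).2) : ((cmDatum L 2 (Matrix.of fun i j : Fin 2 => if i.val + j.val + 1 = 2 then (1 : L) else 0)).Local v × (cmDatum L 1 (Matrix.of fun i j : Fin 1 => if i.val + j.val + 1 = 1 then (1 : L) else 0)).Local v)), ?_, fun _ _ => rfl, fun _ _ => rfl, ?_⟩
  · -- (hwin) THE WINDOW LAW on the deep regular locus: ★ V2 at `T := E₂ t₁`, `T′ := E₂ (e t)₁`, `o := oT t`, `m := oT t − j + i`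
    intro t ht hmfl i _
    have h0 := h00 t ht hmfl
    obtain ⟨hjo, hβv⟩ := hoT t ht hmfl
    have hm : oT t - j + i + j = oT t + i := by omega
    obtain ⟨XA', XB', hA', hB', hF⟩ := exists_windowForms_setIntegral_shellConjugate_sub_eq_hilbertSymbol_mul L v w hw hα hα0 hϖF E₂ K x₀ hK ν hKo hx₀
      huF0 huF1 hu u huu uη hη0 huη hc0 hc hvc (E₂ (t : ((cmDatum L 2 (Matrix.of fun i j : Fin 2 => if i.val + j.val + 1 = 2 then (1 : L) else 0)).Local v × (cmDatum L 1 (Matrix.of fun i j : Fin 1 => if i.val + j.val + 1 = 1 then (1 : L) else 0)).Local v)).1) (E₂ (e (t : ((cmDatum L 2 (Matrix.of fun i j : Fin 2 => if i.val + j.val + 1 = 2 then (1 : L) else 0)).Local v × (cmDatum L 1 (Matrix.of fun i j : Fin 1 => if i.val + j.val + 1 = 1 then (1 : L) else 0)).Local v))).1) (hnf t h0) (hconj (t : ((cmDatum L 2 (Matrix.of fun i j : Fin 2 => if i.val + j.val + 1 = 2 then (1 : L) else 0)).Local v × (cmDatum L 1 (Matrix.of fun i j : Fin 1 => if i.val +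 j.val + 1 = 1 then (1 : L) else 0)).Local v))) hβv hm
    -- the `dite` witnesses ARE V2's elements (same matrix, `U_w → M₂(L_w)` injective)
    have eA : XA i t = XA' := Subtype.ext (Units.ext (by rw [hXA i t ⟨XA', by rw [hA', hMA]⟩, hMA, hA']))
    have eB : XB i t = XB' := Subtype.ext (Units.ext (by rw [hXB i t ⟨XB', by rw [hB', hMB]⟩, hMB, hB']))
    rw [hκT t ht hmfl]
    simp only [prod_symm_one_inv_mul_mul L v w hw E₂, he2, eA, eB]
    exact hF f (t : ((cmDatum L 2 (Matrix.of fun i j : Fin 2 => if i.val + j.val + 1 = 2 then (1 : L) else 0)).Local v × (cmDatum L 1 (Matrix.of fun i j : Fin 1 => if i.val + j.val + 1 = 1 then (1 : L) else 0)).Local v)).2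
  · -- (hcont) CONTINUITY AT A SINGULAR POINT `s`
    intro i _ s hs
    -- `X_s = τ • 1`, `τ ≠ 0`
    obtain ⟨τ, hτ0, hXs⟩ := exists_coe_eq_smul_one_of_not_isRegularElt L v w hw t₀ P d ht₀ hP hd1 E₂ hE₂ s hs
    -- the descent matrix `G_t = diag(1,α) X_t diag(1,α)⁻¹` is continuous along the torus, with `(G_t)₀₀ = (X_t)₀₀`, `(G_t)₁₀ = α (X_t)₁₀`
    have hG := continuous_conj_coe_placeModel L v w hw E₂ t₀ (Matrix.diagonal ![(1 : (w.1.adicCompletion L)), α]) (Matrix.diagonal ![(1 : (w.1.adicCompletion L)), α⁻¹])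
    have hG00 : ∀ t : ↥(Subgroup.centralizer ({t₀} : Set ((cmDatum L 2 (Matrix.of fun i j : Fin 2 => if i.val + j.val + 1 = 2 then (1 : L) else 0)).Local v × (cmDatum L 1 (Matrix.of fun i j : Fin 1 => if i.val + j.val + 1 = 1 then (1 : L) else 0)).Local v))), (Matrix.diagonal ![(1 : (w.1.adicCompletion L)), α] * ((((E₂ (t : ((cmDatum L 2 (Matrix.of fun i j : Fin 2 => if i.val + j.val + 1 = 2 then (1 : L) else 0)).Local v × (cmDatum L 1 (Matrix.of fun i j : Fin 1 => if i.val + j.val + 1 = 1 then (1 : L) else 0)).Local v)).1) : ↥(unitaryGroupOfForm (galAdicCompletionMap (L := L) (IsCMField.complexConj L) hw) (placeForm (Matrix.of fun i j : Fin 2 => if i.val + j.val + 1 = 2 then (1 : L) else 0) w.1))) : GL (Fin 2) (w.1.adicCompletion L)) : Matrix (Fin 2) (Fin 2) (w.1.adicCompletion L)) * Matrix.diagonal ![(1 : (w.1.adicCompletion L)), α⁻¹]) 0 0 = ((((E₂ (t : ((cmDatum L 2 (Matrix.of fun i j : Fin 2 => if i.val + j.val + 1 = 2 then (1 : L) else 0)).Local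 v × (cmDatum L 1 (Matrix.of fun i j : Fin 1 => if i.val + j.val + 1 = 1 then (1 : L) else 0)).Local v)).1) : ↥(unitaryGroupOfForm (galAdicCompletionMap (L := L) (IsCMField.complexConj L) hw) (placeForm (Matrix.of fun i j : Fin 2 => if i.val + j.val + 1 = 2 then (1 : L) else 0) w.1))) : GL (Fin 2) (w.1.adicCompletion L)) : Matrix (Fin 2) (Fin 2) (w.1.adicCompletion L)) 0 0 := by
      intro t
      simp [Matrix.mul_apply, Fin.sum_univ_two]
    have hs0 : ((((E₂ (s : ((cmDatum L 2 (Matrix.of fun i j : Fin 2 => if i.val + j.val + 1 = 2 then (1 : L) else 0)).Local v × (cmDatum L 1 (Matrix.of fun i j : Fin 1 => if i.val + j.val + 1 = 1 then (1 : L) else 0)).Local v)).1) : ↥(unitaryGroupOfForm (galAdicCompletionMap (L := L) (IsCMField.complexConj L) hw) (placeForm (Matrix.of fun i j : Fin 2 => if i.val + j.val + 1 = 2 then (1 : L) else 0) w.1))) : GL (Fin 2) (w.1.adicCompletion L)) : Matrix (Fin 2) (Fin 2) (w.1.adicCompletion L)) 0 0 ≠ 0 := by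
      rw [hXs, Matrix.smul_apply, Matrix.one_apply_eq, smul_eq_mul, mul_one]
      exact hτ0
    have hGs0 : (Matrix.diagonal ![(1 : (w.1.adicCompletion L)), α] * ((((E₂ (s : ((cmDatum L 2 (Matrix.of fun i j : Fin 2 => if i.val + j.val + 1 = 2 then (1 : L) else 0)).Local v × (cmDatum L 1 (Matrix.of fun i j : Fin 1 => if i.val + j.val + 1 = 1 then (1 : L) else 0)).Local v)).1) : ↥(unitaryGroupOfForm (galAdicCompletionMap (L := L) (IsCMField.complexConj L) hw) (placeForm (Matrix.of fun i j : Fin 2 => if i.val + j.val + 1 = 2 then (1 : L) else 0) w.1))) : GL (Fin 2) (w.1.adicCompletion L)) : Matrix (Fin 2) (Fin 2) (w.1.adicCompletion L)) * Matrix.diagonal ![(1 : (w.1.adicCompletion L)), α⁻¹]) 0 0 ≠ 0 := by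
      rw [hG00]
      exact hs0
    -- near `s` the corner is non-zero, so the normal form is available
    have hev : ∀ᶠ t : ↥(Subgroup.centralizer ({t₀} : Set ((cmDatum L 2 (Matrix.of fun i j : Fin 2 => if i.val + j.val + 1 = 2 then (1 : L) else 0)).Local v × (cmDatum L 1 (Matrix.of fun i j : Fin 1 => if i.val + j.val + 1 = 1 then (1 : L) else 0)).Local v))) in 𝓝 s, ((((E₂ (t : ((cmDatum L 2 (Matrix.of fun i j : Fin 2 => if i.val + j.val + 1 = 2 then (1 : L) else 0)).Local v × (cmDatum L 1 (Matrix.of fun i j : Fin 1 => if i.val + j.val + 1 = 1 then (1 : L) else 0)).Local v)).1) : ↥(unitaryGroupOfForm (galAdicCompletionMap (L := L) (IsCMField.complexConj L) hw) (placeForm (Matrix.of fun i j : Fin 2 => if i.val + j.val + 1 = 2 then (1 : L) else 0) w.1))) : GL (Fin 2) (w.1.adicCompletion L)) : Matrix (Fin 2) (Fin 2) (w.1.adicCompletion L)) 0 0 ≠ 0 := by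
      have h := (continuousAt_matrix_apply hG.continuousAt (0 : Fin 2) (0 : Fin 2)).eventually_ne hGs0
      exact h.mono fun t ht => by rwa [hG00] at ht
    -- the entries of the normal form
    have e00 : ∀ t : ↥(Subgroup.centralizer ({t₀} : Set ((cmDatum L 2 (Matrix.of fun i j : Fin 2 => if i.val + j.val + 1 = 2 then (1 : L) else 0)).Local v × (cmDatum L 1 (Matrix.of fun i j : Fin 1 => if i.val + j.val + 1 = 1 then (1 : L) else 0)).Local v))), (ζ t • (!![(1 : (v.adicCompletion ↥(maximalRealSubfield L))), β t * v₀; β t, 1 + β t * u₀]).map (toPlace v w)) 0 0 = ζ t := by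
      intro t
      simp
    have e10 : ∀ t : ↥(Subgroup.centralizer ({t₀} : Set ((cmDatum L 2 (Matrix.of fun i j : Fin 2 => if i.val + j.val + 1 = 2 then (1 : L) else 0)).Local v × (cmDatum L 1 (Matrix.of fun i j : Fin 1 => if i.val + j.val + 1 = 1 then (1 : L) else 0)).Local v))), (ζ t • (!![(1 : (v.adicCompletion ↥(maximalRealSubfield L))), β t * v₀; β t, 1 + β t * u₀]).map (toPlace v w)) 1 0 = ζ t * toPlace v w (β t) := by
      intro t
      simp
    have hζev : ∀ᶠ t : ↥(Subgroup.centralizer ({t₀} : Set ((cmDatum L 2 (Matrix.of fun i j : Fin 2 => if i.val + j.val + 1 = 2 then (1 : L) else 0)).Local v × (cmDatum L 1 (Matrix.of fun i j : Fin 1 => if i.val + j.val + 1 = 1 then (1 : L) else 0)).Local v))) in 𝓝 s, (Matrix.diagonal ![(1 : (w.1.adicCompletion L)), α] * ((((E₂ (t : ((cmDatum L 2 (Matrix.of fun i j : Fin 2 => if i.val + j.val + 1 = 2 then (1 : L) else 0)).Local v × (cmDatum L 1 (Matrix.of fun i j : Fin 1 => if i.val + j.val + 1 = 1 then (1 : L)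 else 0)).Local v)).1) : ↥(unitaryGroupOfForm (galAdicCompletionMap (L := L) (IsCMField.complexConj L) hw) (placeForm (Matrix.of fun i j : Fin 2 => if i.val + j.val + 1 = 2 then (1 : L) else 0) w.1))) : GL (Fin 2) (w.1.adicCompletion L)) : Matrix (Fin 2) (Fin 2) (w.1.adicCompletion L)) * Matrix.diagonal ![(1 : (w.1.adicCompletion L)), α⁻¹]) 0 0 = ζ t :=
      hev.mono fun t h0 => by rw [hnf t h0, e00]
    have hb : ∀ᶠ t : ↥(Subgroup.centralizer ({t₀} : Set ((cmDatum L 2 (Matrix.of fun i j : Fin 2 => if i.val + j.val + 1 = 2 then (1 : L) else 0)).Local v × (cmDatum L 1 (Matrix.of fun i j : Fin 1 => if i.val + j.val + 1 = 1 then (1 : L) else 0)).Local v))) in 𝓝 s, toPlace (E := L) v w (β t) =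
        (Matrix.diagonal ![(1 : (w.1.adicCompletion L)), α] * ((((E₂ (t : ((cmDatum L 2 (Matrix.of fun i j : Fin 2 => if i.val + j.val + 1 = 2 then (1 : L) else 0)).Local v × (cmDatum L 1 (Matrix.of fun i j : Fin 1 => if i.val + j.val + 1 = 1 then (1 : L) else 0)).Local v)).1) : ↥(unitaryGroupOfForm (galAdicCompletionMap (L := L) (IsCMField.complexConj L) hw) (placeForm (Matrix.of fun i j : Fin 2 => if i.val + j.val + 1 = 2 then (1 : L) else 0) w.1))) : GL (Fin 2) (w.1.adicCompletion L)) : Matrix (Fin 2) (Fin 2) (w.1.adicCompletion L)) * Matrix.diagonal ![(1 : (w.1.adicCompletion L)), α⁻¹]) 1 0 / (Matrix.diagonal ![(1 : (w.1.adicCompletion L)), α] * ((((E₂ (t : ((cmDatum L 2 (Matrix.of fun i j : Fin 2 => if i.val + j.val + 1 = 2 then (1 : L) else 0)).Local v × (cmDatum L 1 (Matrix.of fun i j : Fin 1 => if i.val + j.val + 1 = 1 then (1 : L) else 0)).Local v)).1) : ↥(unitaryGroupOfForm (galAdicCompletionMap (L := L) (IsCMField.complexConj L) hw) (placeForm (Matrix.of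 fun i j : Fin 2 => if i.val + j.val + 1 = 2 then (1 : L) else 0) w.1))) : GL (Fin 2) (w.1.adicCompletion L)) : Matrix (Fin 2) (Fin 2) (w.1.adicCompletion L)) * Matrix.diagonal ![(1 : (w.1.adicCompletion L)), α⁻¹]) 0 0 :=
      hev.mono fun t h0 => by
        have hζ0 : ζ t ≠ 0 := by rw [← e00 t, ← hnf t h0, hG00]; exact h0
        rw [hnf t h0, e00, e10, mul_div_cancel_left₀ _ hζ0]
    -- the Eisenstein coordinates are continuous at `s` (★ B-p04)
    obtain ⟨hG00c, hβc⟩ := continuousAt_eisensteinCoords L v w hG.continuousAt hGs0 hb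
    have hζc : ContinuousAt ζ s := hG00c.congr hζev
    -- hence so are the window matrices, and they are the matrices of the window elements near `s`
    have hMAc : ContinuousAt (fun t => MA i t) s := by
      have h := continuousAt_descentForm_windowMatrix (continuous_toPlace v w) (Matrix.diagonal ![(1 : (w.1.adicCompletion L)), α]) (Matrix.diagonal ![(1 : (w.1.adicCompletion L)), α⁻¹])
        u₀ (v₀ * c ^ i * (c ^ j)⁻¹) (c ^ j * (c ^ i)⁻¹) hζc hβc
      exact h.congr (Eventually.of_forall fun t => (hMA i t).symm)
    have hMBc : ContinuousAt (fun t => MB i t) s := by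
      have h := continuousAt_descentForm_windowMatrix (continuous_toPlace v w) (Matrix.diagonal ![(1 : (w.1.adicCompletion L)), α]) (Matrix.diagonal ![(1 : (w.1.adicCompletion L)), α⁻¹])
        u₀ (v₀ * c ^ i * (c ^ j)⁻¹ * uF⁻¹) (c ^ j * (c ^ i)⁻¹ * uF) hζc hβc
      exact h.congr (Eventually.of_forall fun t => (hMB i t).symm)
    have hXAc : ContinuousAt (fun t => (((XA i t : ↥(unitaryGroupOfForm (galAdicCompletionMap (L := L) (IsCMField.complexConj L) hw) (placeForm (Matrix.of fun i j : Fin 2 => if i.val + j.val + 1 = 2 then (1 : L) else 0) w.1))) : GL (Fin 2) (w.1.adicCompletion L)) : Matrix (Fin 2) (Fin 2) (w.1.adicCompletion L))) s :=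
      hMAc.congr (hev.mono fun t h0 => (hXA i t (hmemA i t h0)).symm)
    have hXBc : ContinuousAt (fun t => (((XB i t : ↥(unitaryGroupOfForm (galAdicCompletionMap (L := L) (IsCMField.complexConj L) hw) (placeForm (Matrix.of fun i j : Fin 2 => if i.val + j.val + 1 = 2 then (1 : L) else 0) w.1))) : GL (Fin 2) (w.1.adicCompletion L)) : Matrix (Fin 2) (Fin 2) (w.1.adicCompletion L))) s :=
      hMBc.congr (hev.mono fun t h0 => (hXB i t (hmemB i t h0)).symm)
    exact ⟨continuousAt_windowFamily_centralizer_of_coe L v w hw E₂ t₀ hXAc, continuousAt_windowFamily_centralizer_of_coe L v w hw E₂ t₀ hXBc⟩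

end WindowSide

end Literature.NumberTheory.Rogawski1990

end
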